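import Literature.Barriers.CriticalPhenomena.IsingTrivialityFromDimensionFourWick
import Literature.Barriers.CriticalPhenomena.IsingTrivialityFromDimensionFourHighDim
import Literature.Barriers.CriticalPhenomena.IsingTreeDiagramBoundGraph
import Literature.Probability.LatticeModels.AizenmanWickBoundProofs
import Literature.Probability.LatticeModels.HighDimTrivialityPanisProofs
import Literature.Probability.LatticeModels.ImprovedTreeDiagramBoundSum
import Literature.Probability.LatticeModels.HighDimPointwiseTriviality
import Literature.Probability.LatticeModels.SlidingScaleInfraredBoundProofs
import HarnessLib

/-!
# Barrier `IsingTrivialityFromDimensionFour`: assembly from two named facts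

Third sibling proof file of `Literature.Barriers.CriticalPhenomena.IsingTrivialityFromDimensionFour`
(theorems only; no statement, definition or named fact is introduced or changed). It combines

* `IsingTrivialityFromDimensionFourWick` — the random-current input of Aizenman–Duminil-Copin's
  Proposition 1.4 in the form printed by its source, Aizenman 1982, Prop. 12.1
  (`Literature.Probability.LatticeModels.aizenman_wickDeviation_le_finite`), and the reduction of
  the barrier to the smallness `Σ_L⁻² ∑_{Λ_{rL}⁴} |U₄| → 0` at `β_c` of the free state
  (`tendsto_criticalSmearedMGF_one_of_wickBounds`);
* `IsingTrivialityFromDimensionFourHighDim` — for `d ≥ 5` that smallness from the finite-graph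
  tree diagram bound `treeDiagramBound` and theorems of the tree (infrared bound at `β_c`,
  Messager–Miracle-Solé, Griffiths), `ursellFourSum_criticalBeta_le_of_treeDiagramBound`;
* `IsingTreeDiagramBoundGraph` — the discharge `treeDiagramBound_holds` (Aizenman 1982;
  Aizenman CDM 2020, Lemma 8.1 / eq. (8.2)),

into `IsingTrivialityFromDimensionFour.of_wickDeviation_of_ursellFourSum_le`: **the barrier follows
from exactly two named facts of the tree**, Aizenman 1982, Prop. 12.1 in finite volume
(`aizenman_wickDeviation_le_finite`) and the `d = 4` logarithmic bound on `∑ |U₄|` at `β_c`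
(`aizenmanDuminilCopin_ursellFourSum_le`, Aizenman–Duminil-Copin 2021, Thm 1.3 with §6.3 — the
multiscale improvement of the tree diagram bound, specific to `d = 4`); the free DLR state
(`exists_freeMeasure_holds`), the continuity `m*(β_c) = 0` (Aizenman–Duminil-Copin–Sidoravicius 2015,
`spontaneousMagnetization_criticalBeta_eq_zero_holds`), Newman's Gaussian lower bound
(`aizenman_nPoint_le_pairingSum_finite_holds`) and the tree diagram bound (`treeDiagramBound_holds`)
being theorems; and, with the discharge `aizenman_wickDeviation_le_finite_holds`
(`AizenmanWickBoundProofs`, Aizenman 1982, Prop. 12.1 proved through the random-walk representation),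
`IsingTrivialityFromDimensionFour.of_ursellFourSum_le`: **the barrier follows from the single named fact
`aizenmanDuminilCopin_ursellFourSum_le`** (Aizenman–Duminil-Copin 2021, Thm 1.3 with §6.3).
Compare `IsingTrivialityFromDimensionFour.of_wickDeviation` (three facts: the
`d ≥ 5` input is the DLR-state fact `panis_ursellFourSum_le`) and
`IsingTrivialityFromDimensionFour.of_treeDiagramBound` (whose first hypothesis
`aizenman_pairingSum_sub_nPoint_le_finite`, the `S_{2n-4}` form of Aizenman's inequality quoted in
Aizenman–Duminil-Copin 2021, §6.3, is refuted in `AizenmanWickBoundLocal`,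
`not_aizenman_pairingSum_sub_nPoint_le_finite`).

**After the discharges (2026-08-15).** Two further inputs have since become theorems of the tree:
Panis's Theorem 5.5 for the nearest-neighbour model, `d ≥ 5`
(`Literature.Probability.LatticeModels.panis_mgf_normalizedField_bound_holds`, `HighDimTrivialityPanisProofs`),
and the §6.3 summation of Aizenman–Duminil-Copin 2021
(`Literature.Probability.LatticeModels.aizenmanDuminilCopin_ursellFourSum_le_of_facts`,
`ImprovedTreeDiagramBoundSum`, which proves `aizenmanDuminilCopin_ursellFourSum_le` from the paper's
numbered Theorem 1.3 — `aizenmanDuminilCopin_improvedTreeDiagramBound`, the improved tree diagram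
bound — and Theorem 5.6 — `aizenmanDuminilCopin_slidingScaleInfraredBound`, the sliding-scale
infrared bound). Consequently (last section of this file):

* the statement file's two `d > 4` named facts are DISCHARGED —
  `criticalSmearedMGF_bound_highDim_abs_holds` (general `f`, the printed `|f|`-prefactor; Aizenman
  CDM 2020 (7.9)–(7.10) with (8.5), Panis 2023 Thm 5.5) and `criticalSmearedMGF_bound_highDim_nonneg_holds`
  (`f ≥ 0`, the display of Duminil-Copin ICM 2022 §6.4), through `….of_facts` of
  `IsingTrivialityFromDimensionFourProofs` and `m*(β_c) = 0` (`spontaneousMagnetization_criticalBeta_eq_zero_holds`);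
* the barrier, its no-go corollary and the statement file's `d = 4` display
  `criticalSmearedMGF_bound_four_nonneg` rest on exactly the two numbered theorems of
  Aizenman–Duminil-Copin 2021 that are still named facts, Theorem 1.3 and Theorem 5.6:
  `IsingTrivialityFromDimensionFour.of_adc`, `not_dimensionUniform_hasNonGaussianCriticalSmearing_of_adc`,
  `criticalSmearedMGF_bound_four_nonneg.of_ursellFourSum_le` / `.of_adc`. Once both are discharged,
  `IsingTrivialityFromDimensionFour_holds` is the one-liner `IsingTrivialityFromDimensionFour.of_adc T13 T56`;
* the POINTWISE no-go of the statement file (the summit's own clause (iii) vocabulary) is unconditional for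
  `d ≥ 5`: crit-ising.S13's `Literature.Probability.LatticeModels.limitConnectedFour_eq_zero_of_hasPointwiseScalingLimit`
  is the theorem `…_holds` of `HighDimPointwiseTriviality` (Aizenman 1982 / Fröhlich 1982: tree diagram bound,
  infrared bound, dimension count), whence `not_hasConformalLimitIn_of_five_le'`,
  `not_dimensionUniform_hasConformalLimitIn'` (**the natural strengthening of `Ising3DConformalLimit` to all
  `d ≥ 3` is false, unconditionally**), `not_dimensionUniform_hasNonGaussianPointwiseLimit'` and
  `eq_three_or_four_of_hasNonGaussianPointwiseLimit'`.

**After the discharge of Theorem 5.6 (2026-08-15).** The sliding-scale infrared bound is now the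
theorem `Literature.Probability.LatticeModels.aizenmanDuminilCopin_slidingScaleInfraredBound_holds`
(`SlidingScaleInfraredBoundProofs`: the spectral representation of the transfer matrix and the
Fourier argument of Aizenman–Duminil-Copin 2021, §5.2–5.3). Consequently (final section of this file)
the barrier, its no-go corollary and the `d = 4` display rest on **exactly one named fact of the tree,
the paper's Theorem 1.3** (the improved tree diagram bound in `d = 4`,
`aizenmanDuminilCopin_improvedTreeDiagramBound`, proved in print by the multi-scale analysis of
random-current intersections of §4 made unconditional in §6.1–6.2):
`IsingTrivialityFromDimensionFour.of_improvedTreeDiagramBound`,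
`not_dimensionUniform_hasNonGaussianCriticalSmearing_of_improvedTreeDiagramBound`,
`criticalSmearedMGF_bound_four_nonneg.of_improvedTreeDiagramBound`. Once Theorem 1.3 is discharged,
`IsingTrivialityFromDimensionFour_holds` is the one-liner
`IsingTrivialityFromDimensionFour.of_improvedTreeDiagramBound T13`.

## References

* M. Aizenman, Comm. Math. Phys. 86 (1982) 1–48, Prop. 12.1 and §5 [AizenmanCMP1982].
* M. Aizenman, CDM 2020 (arXiv:2112.04248), §7 Cor. 7.3, Lemma 8.1, §8.1 eq. (8.5) [AizenmanCDM2020].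
* M. Aizenman, H. Duminil-Copin, Ann. of Math. 194 (2021) (arXiv:1912.07973), Thm 1.3, Prop. 1.4,
  §6.3 (p. 26); Thm 5.6 (p. 18) [AizenmanDuminilCopinAnnals2021].
* R. Panis, Ann. Probab. 54 (2026) (arXiv:2309.05797), Thm 5.5 [Panis2023Triviality].
* H. Duminil-Copin, Proc. ICM 2022, §6.4, §8.1 [DuminilCopinICM2022].
* M. Aizenman, Comm. Math. Phys. 86 (1982), §1 and Prop. 5.3 [AizenmanCMP1982]; J. Fröhlich, Nucl. Phys. B 200 (1982) [FrohlichTrivialityNPB1982].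
-/

noncomputable section

open MeasureTheory Filter Topology Finset
open Literature.Probability.LatticeModels Literature.Probability.Percolation

namespace Literature.Barriers.CriticalPhenomena

/-- **`S(μ; L, r) → 0` at `β_c` for `d ≥ 5`, for the free state**, from the tree diagram bound
(a theorem, `treeDiagramBound_holds`) through
`ursellFourSum_criticalBeta_le_of_treeDiagramBound`: `S(μ;L,r) ≤ C r^{4d}/L^{d-4} → 0`
(Aizenman CDM 2020, §8.1 eq. (8.5)). [cite: AizenmanCDM2020, §8.1 eq. (8.5)] -/
theorem tendsto_ursellFourSum_zero_of_freeCorr_of_five_le {d : ℕ} (hd : 5 ≤ d)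
    {μ : Measure (SpinConfig (Site d))} [IsProbabilityMeasure μ]
    (hTI : IsTranslationInvariantMeasure μ)
    (hcorr : ∀ A : Finset (Site d), spinCorr μ A = freeCorr d (criticalBeta d) 0 A)
    {r : ℝ} (hr : 1 ≤ r) : Tendsto (fun L : ℕ => ursellFourSum μ L r) atTop (𝓝 0) := by
  obtain ⟨C, -, H⟩ := ursellFourSum_criticalBeta_le_of_treeDiagramBound (d := d)
    treeDiagramBound_holds hd
  set K : ℝ := C * r ^ (4 * d) with hK
  have hup : Tendsto (fun L : ℕ => K / (L : ℝ) ^ (d - 4)) atTop (𝓝 0) := by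
    have hpow : Tendsto (fun L : ℕ => ((L : ℝ) ^ (d - 4))⁻¹) atTop (𝓝 0) := by
      have h1 : Tendsto (fun x : ℝ => x ^ (d - 4)) atTop atTop := tendsto_pow_atTop (by omega)
      exact (h1.comp tendsto_natCast_atTop_atTop).inv_tendsto_atTop
    simpa [div_eq_mul_inv] using hpow.const_mul K
  refine squeeze_zero' (Eventually.of_forall fun L => ursellFourSum_nonneg μ L r) ?_ hup
  filter_upwards [eventually_ge_atTop 1] with L hL
  have h := H μ hTI hcorr (L : ℝ) r (Nat.one_le_cast.mpr hL) hr
  simpa only [hK] using h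

/-- **The barrier from two named facts.** `IsingTrivialityFromDimensionFour` — for every `d ≥ 4`
the critical nearest-neighbour Ising model on `ℤ^d` has no non-Gaussian smeared scaling limit —
granted (i) Aizenman 1982, Prop. 12.1 in finite volume, in the form printed by its source
(`aizenman_wickDeviation_le_finite`), and (ii) the `d = 4` bound
`Σ_L⁻² ∑_{Λ_{rL}⁴} |U₄| ≤ C r¹² (log L)^{-c}` at `β_c` (`aizenmanDuminilCopin_ursellFourSum_le`,
Aizenman–Duminil-Copin 2021, Thm 1.3 with §6.3). For `d ≥ 5` the smallness of `∑ |U₄|` is the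
theorem `tendsto_ursellFourSum_zero_of_freeCorr_of_five_le` (tree diagram bound, proved, and the
infrared bound at `β_c`); the free DLR state, `m*(β_c) = 0`, Newman's lower bound, the flip
symmetry, the smearing and the summation over `n` are theorems of the tree
(`tendsto_criticalSmearedMGF_one_of_wickBounds`). [cite: AizenmanCMP1982, Prop. 12.1] [cite: AizenmanDuminilCopinAnnals2021, Thm 1.3, Prop. 1.4 and §6.3 (p. 26)] [cite: AizenmanCDM2020, §7 Cor. 7.3 and §8.1 eq. (8.5)] -/
theorem IsingTrivialityFromDimensionFour.of_wickDeviation_of_ursellFourSum_le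
    (hW : aizenman_wickDeviation_le_finite) (hS₄ : aizenmanDuminilCopin_ursellFourSum_le) :
    IsingTrivialityFromDimensionFour := by
  intro d hd
  rintro ⟨f, hf, hfs, z, -, hnot⟩
  refine hnot ?_
  have hβ := criticalBeta_nonneg d
  have hm' : spontaneousMagnetization d (criticalBeta d) = 0 :=
    spontaneousMagnetization_criticalBeta_eq_zero_holds (d := d) (by omega)
  obtain ⟨μ, hμG, hTI, hcorr⟩ := exists_freeMeasure_holds d (β := criticalBeta d) 0 hβ le_rfl
  haveI : IsProbabilityMeasure μ := hμG.1
  have hμ : ∀ A, spinCorr μ A = plusCorr d (criticalBeta d) 0 A := fun A =>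
    (hcorr A).trans (freeCorr_eq_plusCorr_of_spontaneousMagnetization_eq_zero hβ hm' A)
  have hodd : ∀ {n : ℕ}, Odd n → ∀ x : Fin n → Site d, ∫ σ, ∏ i, spinAt (x i) σ ∂μ = 0 :=
    fun hn x => integral_prod_spinAt_eq_zero_of_freeCorr hβ hcorr hn x
  obtain ⟨hlow, hWμ⟩ := pairingLowerBound_and_wickDeviationBound_of_freeCorr hW hβ hcorr
  have hS : ∀ r : ℝ, 1 ≤ r → Tendsto (fun L : ℕ => ursellFourSum μ L r) atTop (𝓝 0) := by
    intro r hr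
    rcases hd.eq_or_lt with h4 | hlt
    · subst h4
      exact tendsto_ursellFourSum_zero_four hS₄ hμG hr
    · exact tendsto_ursellFourSum_zero_of_freeCorr_of_five_le hlt hTI hcorr hr
  exact tendsto_criticalSmearedMGF_one_of_wickBounds hμG hTI hμ hlow hWμ hodd hS hf hfs z

/-- Consequently no dimension-uniform derivation of non-triviality, granted the same two facts
(`IsingTrivialityFromDimensionFour.not_dimensionUniform`). [cite: AizenmanCDM2020, §11 (1)] -/
theorem not_dimensionUniform_hasNonGaussianCriticalSmearing_of_two_facts
    (hW : aizenman_wickDeviation_le_finite) (hS₄ : aizenmanDuminilCopin_ursellFourSum_le) :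
    ¬ DimensionUniform HasNonGaussianCriticalSmearing :=
  (IsingTrivialityFromDimensionFour.of_wickDeviation_of_ursellFourSum_le hW hS₄).not_dimensionUniform

/-- **The barrier from one named fact.** `IsingTrivialityFromDimensionFour` granted only the `d = 4`
bound `Σ_L⁻² ∑_{Λ_{rL}⁴} |U₄| ≤ C r¹² (log L)^{-c}` at `β_c` (`aizenmanDuminilCopin_ursellFourSum_le`,
Aizenman–Duminil-Copin 2021, Thm 1.3 with §6.3, the multiscale improvement of the tree diagram bound):
Aizenman's Prop. 12.1 is now the theorem `aizenman_wickDeviation_le_finite_holds`. [cite: AizenmanDuminilCopinAnnals2021, Thm 1.3, Prop. 1.4 and §6.3 (p. 26)] [cite: AizenmanCMP1982, Prop. 12.1] -/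
theorem IsingTrivialityFromDimensionFour.of_ursellFourSum_le (hS₄ : aizenmanDuminilCopin_ursellFourSum_le) :
    IsingTrivialityFromDimensionFour :=
  IsingTrivialityFromDimensionFour.of_wickDeviation_of_ursellFourSum_le aizenman_wickDeviation_le_finite_holds hS₄

/-- Consequently no dimension-uniform derivation of non-triviality, granted that one fact. [cite: AizenmanCDM2020, §11 (1)] -/
theorem not_dimensionUniform_hasNonGaussianCriticalSmearing_of_ursellFourSum_le
    (hS₄ : aizenmanDuminilCopin_ursellFourSum_le) : ¬ DimensionUniform HasNonGaussianCriticalSmearing :=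
  (IsingTrivialityFromDimensionFour.of_ursellFourSum_le hS₄).not_dimensionUniform


/-! ### After the discharges of Aizenman's Prop. 12.1 and Panis's Thm 5.5, and the proof of the
§6.3 summation (2026-08-15) -/

/-- **Discharge of the statement file's `d > 4` named fact `criticalSmearedMGF_bound_highDim_abs`**
(Gaussianity of the critical smeared spins in `d > 4` with the printed `|f|`-prefactor: Aizenman
1982 / Fröhlich 1982 as restated by Aizenman, CDM 2020, (7.9)–(7.10) with (8.5); Panis 2023,
Thm 5.5, at `β = β_c`). Panis's Theorem 5.5 for the nearest-neighbour model, `d ≥ 5`, is the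
theorem `panis_mgf_normalizedField_bound_holds` (`HighDimTrivialityPanisProofs`: tree-form Aizenman
inequality with coincident points, infrared bounds, summation over `n`), `m*(β_c) = 0` is
`spontaneousMagnetization_criticalBeta_eq_zero_holds` (Aizenman–Duminil-Copin–Sidoravicius 2015), and
the passage to the `plusExpect` vocabulary (free DLR state, division by `exp((z²/2)⟨T_{f,L}²⟩)`) is
`criticalSmearedMGF_bound_highDim_abs.of_facts` of `IsingTrivialityFromDimensionFourProofs`.
[cite: Panis2023Triviality, Thm. 5.5 (with its proof, pp. 21–22)] [cite: AizenmanCDM2020, §7 eqs. (7.9)–(7.10) and §8.1 eq. (8.5)] [cite: AizenmanCMP1982, Prop. 12.1] -/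
theorem criticalSmearedMGF_bound_highDim_abs_holds : criticalSmearedMGF_bound_highDim_abs :=
  criticalSmearedMGF_bound_highDim_abs.of_facts panis_mgf_normalizedField_bound_holds
    fun {_} => spontaneousMagnetization_criticalBeta_eq_zero_holds

/-- **Discharge of the statement file's `d > 4` named fact `criticalSmearedMGF_bound_highDim_nonneg`**
(the display of Duminil-Copin, ICM 2022, §6.4, at `β = β_c` for `f ≥ 0`: for `d > 4` and
`f ∈ C_c(ℝ^d)`, `f ≥ 0`, some `C_f > 0`, all `L ≥ 1` and real `z`,
`|⟨exp[z T_{f,L} - (z²/2)⟨T_{f,L}²⟩]⟩_{β_c} - 1| ≤ C_f z⁴ / L^{d-4}`): the `f ≥ 0` case of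
`criticalSmearedMGF_bound_highDim_abs_holds` (`criticalSmearedMGF_bound_highDim_abs.nonneg`, the
ratio prefactor being `exp 0 = 1`). [cite: DuminilCopinICM2022, §6.4 (display)] [cite: Panis2023Triviality, Thm. 5.5] [cite: AizenmanCDM2020, §7 eq. (7.9) and §8.1 eq. (8.5)] -/
theorem criticalSmearedMGF_bound_highDim_nonneg_holds : criticalSmearedMGF_bound_highDim_nonneg :=
  criticalSmearedMGF_bound_highDim_abs_holds.nonneg

/-- The `d > 4`, `f ≥ 0` limit `⟨exp[z T_{f,L} - (z²/2)⟨T_{f,L}²⟩]⟩_{β_c} → 1`, now unconditional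
(`tendsto_criticalSmearedMGF_highDim_of_nonneg` of the statement file fed with
`criticalSmearedMGF_bound_highDim_nonneg_holds`). [cite: DuminilCopinICM2022, §6.4] -/
theorem tendsto_criticalSmearedMGF_highDim_of_nonneg' {d : ℕ} (hd : 4 < d)
    {f : EuclideanSpace ℝ (Fin d) → ℝ} (hf : Continuous f) (hfs : HasCompactSupport f)
    (hf0 : ∀ x, 0 ≤ f x) (z : ℝ) :
    Tendsto (fun L : ℕ => criticalSmearedMGF d f L z) atTop (𝓝 1) :=
  tendsto_criticalSmearedMGF_highDim_of_nonneg criticalSmearedMGF_bound_highDim_nonneg_holds hd hf hfs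
    hf0 z

/-- The statement file's `d = 4` display `criticalSmearedMGF_bound_four_nonneg` (Aizenman–Duminil-Copin
2021, Prop. 1.4 in the form its proof establishes: `f ≥ 0` vanishing outside `[-r, r]⁴`, `r ≥ 1`)
from the single named fact `aizenmanDuminilCopin_ursellFourSum_le` (ADC Thm 1.3 with §6.3), Aizenman's
Prop. 12.1 being the theorem `aizenman_wickDeviation_le_finite_holds`
(`criticalSmearedMGF_bound_four_nonneg.of_wickDeviation` of `IsingTrivialityFromDimensionFourWick`).
[cite: AizenmanDuminilCopinAnnals2021, Proposition 1.4 (p. 6) with §6.3 (p. 26)] [cite: AizenmanCMP1982, Prop. 12.1] -/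
theorem criticalSmearedMGF_bound_four_nonneg.of_ursellFourSum_le
    (hS₄ : aizenmanDuminilCopin_ursellFourSum_le) : criticalSmearedMGF_bound_four_nonneg :=
  criticalSmearedMGF_bound_four_nonneg.of_wickDeviation aizenman_wickDeviation_le_finite_holds hS₄

/-- **The barrier from the two numbered theorems of Aizenman–Duminil-Copin 2021 that remain named
facts**: `IsingTrivialityFromDimensionFour` — for every `d ≥ 4` the critical nearest-neighbour Ising
model on `ℤ^d` has no non-Gaussian smeared scaling limit — granted Theorem 1.3, the improved tree
diagram bound in `d = 4` (`aizenmanDuminilCopin_improvedTreeDiagramBound`: for `β ≤ β_c`, `L ≤ ξ(β)`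
and `x, y, z, t` at mutual distance `> L`,
`|U₄^β(x,y,z,t)| ≤ C B_L(β)^{-c} ∑_u ⟨σ_uσ_x⟩⟨σ_uσ_y⟩⟨σ_uσ_z⟩⟨σ_uσ_t⟩`, proved in print by the
multi-scale analysis of random-current intersections, §4 and §6.1–6.2), and Theorem 5.6, the
sliding-scale infrared bound (`aizenmanDuminilCopin_slidingScaleInfraredBound`:
`χ_L(β)/L² ≤ (C/β) χ_ℓ(β)/ℓ²` for `β ≤ β_c`, `1 ≤ ℓ ≤ L`, `d > 2`, proved in print from the
spectral representation of the two-point function, §5.3). The §6.3 summation turning them into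
`Σ_L⁻² ∑_{Λ_{rL}⁴} |U₄| ≤ C r¹² (log L)^{-c}` is the theorem
`aizenmanDuminilCopin_ursellFourSum_le_of_facts` (`ImprovedTreeDiagramBoundSum`); everything else
(Aizenman's Prop. 12.1, the tree diagram bound, the free DLR state, `m*(β_c) = 0`, Newman's lower
bound, the infrared bound at `β_c`, the smearing and the summation over `n`) is a theorem, see
`IsingTrivialityFromDimensionFour.of_ursellFourSum_le`. Once Theorems 1.3 and 5.6 are discharged,
`IsingTrivialityFromDimensionFour_holds := IsingTrivialityFromDimensionFour.of_adc T13 T56`.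
[cite: AizenmanDuminilCopinAnnals2021, arXiv:1912.07973 Theorem 1.3 (p. 6), Theorem 5.6 (p. 18), Proposition 1.4 and §6.3 (pp. 26–27)] -/
theorem IsingTrivialityFromDimensionFour.of_adc
    (h13 : aizenmanDuminilCopin_improvedTreeDiagramBound)
    (h56 : aizenmanDuminilCopin_slidingScaleInfraredBound) : IsingTrivialityFromDimensionFour :=
  IsingTrivialityFromDimensionFour.of_ursellFourSum_le
    (aizenmanDuminilCopin_ursellFourSum_le_of_facts h13 h56)

/-- Consequently no dimension-uniform derivation of non-triviality of the critical Ising model,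
granted ADC Theorems 1.3 and 5.6 (`IsingTrivialityFromDimensionFour.not_dimensionUniform`).
[cite: AizenmanDuminilCopinAnnals2021, §1.1 and Theorem 1.3] [cite: AizenmanCDM2020, §11 (1)] -/
theorem not_dimensionUniform_hasNonGaussianCriticalSmearing_of_adc
    (h13 : aizenmanDuminilCopin_improvedTreeDiagramBound)
    (h56 : aizenmanDuminilCopin_slidingScaleInfraredBound) :
    ¬ DimensionUniform HasNonGaussianCriticalSmearing :=
  (IsingTrivialityFromDimensionFour.of_adc h13 h56).not_dimensionUniform

/-- The statement file's `d = 4` display `criticalSmearedMGF_bound_four_nonneg` granted ADC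
Theorems 1.3 and 5.6 only. [cite: AizenmanDuminilCopinAnnals2021, Proposition 1.4 (p. 6), Theorem 1.3, Theorem 5.6 and §6.3 (p. 26)] -/
theorem criticalSmearedMGF_bound_four_nonneg.of_adc
    (h13 : aizenmanDuminilCopin_improvedTreeDiagramBound)
    (h56 : aizenmanDuminilCopin_slidingScaleInfraredBound) : criticalSmearedMGF_bound_four_nonneg :=
  criticalSmearedMGF_bound_four_nonneg.of_ursellFourSum_le
    (aizenmanDuminilCopin_ursellFourSum_le_of_facts h13 h56)


/-! ### The pointwise no-go in `d ≥ 5`, unconditional (crit-ising.S13 discharged) -/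

/-- **Clause (iii) fails pointwise in every `d ≥ 5`, unconditionally**: no renormalised pointwise
scaling limit of the critical correlators on `ℤ^d`, `d ≥ 5`, has a non-degenerate two-point
function and `U₄ ≢ 0` — `not_hasNonGaussianPointwiseLimit_of_five_le` of the statement file fed
with the theorem `limitConnectedFour_eq_zero_of_hasPointwiseScalingLimit_holds`
(`HighDimPointwiseTriviality`: Aizenman's dimension count — tree diagram bound, infrared bound at
`β_c`, Messager–Miracle-Solé — for the plus state at `β_c`). [cite: AizenmanCMP1982, §1 (Prop. 1.2) with Prop. 5.3] [cite: FrohlichTrivialityNPB1982] [cite: AizenmanCDM2020, §8.1 eqs. (8.2), (8.4) and §10.1 eqs. (10.1)–(10.2)] -/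
theorem not_hasNonGaussianPointwiseLimit_of_five_le' {d : ℕ} (hd : 5 ≤ d) :
    ¬ HasNonGaussianPointwiseLimit d :=
  not_hasNonGaussianPointwiseLimit_of_five_le
    limitConnectedFour_eq_zero_of_hasPointwiseScalingLimit_holds hd

/-- Hence the conformal target `HasConformalLimitIn d` (the sub-problem `Ising3DConformalLimit` with
`3` replaced by `d`) fails in every `d ≥ 5`, unconditionally (at clause (iii)).
[cite: DuminilCopinICM2022, §6.4 and §8.1] [cite: AizenmanCMP1982, §1] -/
theorem not_hasConformalLimitIn_of_five_le' {d : ℕ} (hd : 5 ≤ d) : ¬ HasConformalLimitIn d :=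
  not_hasConformalLimitIn_of_five_le limitConnectedFour_eq_zero_of_hasPointwiseScalingLimit_holds hd

/-- **The natural strengthening of `Ising3DConformalLimit` to all `d ≥ 3` is false — unconditionally**
(already at `d = 5`): no dimension-uniform derivation of the summit conjunct
(`not_dimensionUniform_hasConformalLimitIn` of the statement file, its crit-ising.S13 hypothesis
being the theorem `limitConnectedFour_eq_zero_of_hasPointwiseScalingLimit_holds`).
[cite: DuminilCopinICM2022, §6.4] [cite: AizenmanCDM2020, §1 and §11 (1)] [cite: AizenmanCMP1982, §1] -/
theorem not_dimensionUniform_hasConformalLimitIn' : ¬ DimensionUniform HasConformalLimitIn :=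
  not_dimensionUniform_hasConformalLimitIn limitConnectedFour_eq_zero_of_hasPointwiseScalingLimit_holds

/-- The same for clause (iii) alone (pointwise form), unconditionally. [cite: DuminilCopinICM2022, §6.4] [cite: AizenmanCMP1982, §1] -/
theorem not_dimensionUniform_hasNonGaussianPointwiseLimit' :
    ¬ DimensionUniform HasNonGaussianPointwiseLimit :=
  not_dimensionUniform_hasNonGaussianPointwiseLimit
    limitConnectedFour_eq_zero_of_hasPointwiseScalingLimit_holds

/-- Within `d ≥ 3`, a non-Gaussian pointwise critical limit forces `d ∈ {3, 4}`, unconditionally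
(the pointwise `d = 4` statement is not in the tree; in the smeared form `d = 4` is excluded by
`IsingTrivialityFromDimensionFour`, granted ADC Theorems 1.3 and 5.6, `IsingTrivialityFromDimensionFour.of_adc`).
[cite: AizenmanCMP1982, §1] [cite: AizenmanDuminilCopinAnnals2021, §1.1 and Theorem 1.2] -/
theorem eq_three_or_four_of_hasNonGaussianPointwiseLimit' {d : ℕ} (hd : 3 ≤ d)
    (h : HasNonGaussianPointwiseLimit d) : d = 3 ∨ d = 4 :=
  eq_three_or_four_of_hasNonGaussianPointwiseLimit
    limitConnectedFour_eq_zero_of_hasPointwiseScalingLimit_holds hd h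


/-! ### After the discharge of Theorem 5.6: the barrier from Theorem 1.3 alone -/

/-- **The barrier from the single numbered theorem of Aizenman–Duminil-Copin 2021 that remains a
named fact, Theorem 1.3** (the improved tree diagram bound in `d = 4`,
`aizenmanDuminilCopin_improvedTreeDiagramBound`: for `β ≤ β_c`, `L ≤ ξ(β)` and `x, y, z, t` at
mutual distance `≥ L`, `|U₄^β(x,y,z,t)| ≤ C B_L(β)^{-c} ∑_u ⟨σ_uσ_x⟩⟨σ_uσ_y⟩⟨σ_uσ_z⟩⟨σ_uσ_t⟩`).
Theorem 5.6, the sliding-scale infrared bound `χ_L(β)/L² ≤ (C/β) χ_ℓ(β)/ℓ²`, is the theorem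
`aizenmanDuminilCopin_slidingScaleInfraredBound_holds` (`SlidingScaleInfraredBoundProofs`, from the
spectral representation, §5.2–5.3), fed here into `IsingTrivialityFromDimensionFour.of_adc`; the
§6.3 summation (`aizenmanDuminilCopin_ursellFourSum_le_of_facts`), Aizenman's Prop. 12.1
(`aizenman_wickDeviation_le_finite_holds`), the tree diagram bound, the free DLR state,
`m*(β_c) = 0`, Newman's Gaussian lower bound, the infrared bound at `β_c` and the smearing /
summation over `n` are theorems (see `IsingTrivialityFromDimensionFour.of_ursellFourSum_le`).
Once Theorem 1.3 is discharged,
`IsingTrivialityFromDimensionFour_holds := IsingTrivialityFromDimensionFour.of_improvedTreeDiagramBound T13`.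
[cite: AizenmanDuminilCopinAnnals2021, arXiv:1912.07973 Theorem 1.3 (p. 6), Theorem 5.6 (p. 18), Proposition 1.4 and §6.3 (p. 26)] -/
theorem IsingTrivialityFromDimensionFour.of_improvedTreeDiagramBound
    (h13 : aizenmanDuminilCopin_improvedTreeDiagramBound) : IsingTrivialityFromDimensionFour :=
  IsingTrivialityFromDimensionFour.of_adc h13 aizenmanDuminilCopin_slidingScaleInfraredBound_holds

/-- Consequently no dimension-uniform derivation of non-triviality of the critical Ising model,
granted ADC Theorem 1.3 only (`IsingTrivialityFromDimensionFour.not_dimensionUniform`).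
[cite: AizenmanDuminilCopinAnnals2021, §1.1 and Theorem 1.3] [cite: AizenmanCDM2020, §11 (1)] -/
theorem not_dimensionUniform_hasNonGaussianCriticalSmearing_of_improvedTreeDiagramBound
    (h13 : aizenmanDuminilCopin_improvedTreeDiagramBound) :
    ¬ DimensionUniform HasNonGaussianCriticalSmearing :=
  (IsingTrivialityFromDimensionFour.of_improvedTreeDiagramBound h13).not_dimensionUniform

/-- The statement file's `d = 4` display `criticalSmearedMGF_bound_four_nonneg` (Aizenman–Duminil-Copin
2021, Prop. 1.4 in the form its proof establishes) granted ADC Theorem 1.3 only, Theorem 5.6 being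
the theorem `aizenmanDuminilCopin_slidingScaleInfraredBound_holds`.
[cite: AizenmanDuminilCopinAnnals2021, Proposition 1.4 (p. 6), Theorem 1.3, Theorem 5.6 and §6.3 (p. 26)] -/
theorem criticalSmearedMGF_bound_four_nonneg.of_improvedTreeDiagramBound
    (h13 : aizenmanDuminilCopin_improvedTreeDiagramBound) : criticalSmearedMGF_bound_four_nonneg :=
  criticalSmearedMGF_bound_four_nonneg.of_adc h13 aizenmanDuminilCopin_slidingScaleInfraredBound_holds

end Literature.Barriers.CriticalPhenomena

end
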